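import Summits.CriticalPhenomena.PercolationContinuityZ3.Theorems.Transplant.BoxProdZ2ConcRealised
import Summits.CriticalPhenomena.PercolationContinuityZ3.Theorems.Transplant.KNCells2AnchorNorm
import Summits.CriticalPhenomena.PercolationContinuityZ3.Theorems.Transplant.SkelConcSchedule
import HarnessLib

/-!
# L6 (C)/(R)/(F) shared bookkeeping for the generic design-(D) re-typing: REALISED anchor configurations of a chosen edge for EVERY
# unit-increment scheme, the anchor–norm bound in `nQ` form, and the root/onward facts of the cell geometry of record `Skel.cellGeomSG`
# — generic twin of `BoxProdZ2ConcRealised` §2 (the arithmetic §1/§3 is imported verbatim: `BoxProdZ2.Realised`, `nS_eq`, `sched_hyps`)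

builds on p205010 (kernel theorem, internal audit signed; external expert review pending) — nothing in this file uses p205010.
Lane `prim-bschramm`, seat `prim-bschramm-p5` (gen 4; holder of the L6 (C) residue port, p3-g4 pick 19:36:29Z), helper file
(`--supports stmt-CriticalPhenomena-4575`).

* `Skel.realised_of_choice` — for ANY `S : KSchA V ℕ` with the re-centring rule `anchor a v P = a + 1`, `a₀ = 0`: the anchors
  `(aOf₁, aOf₂)` of a chosen edge and its target cell are `BoxProdZ2.Realised` (the product's proof, verbatim over `V`);
* `Skel.l1_tgt_le_nQ` — `‖tgt e‖₁ ≤ nQ (aOf₁) (tgt e)` at every chosen edge (p2-g3's `KNCells2AnchorNorm` in the form p2-g3's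
  `Skel.concRadiiS_rQ_eq_of_norm_le` consumes: the position-inflated cube radius is INACTIVE at every run pair);
* for the scheme `⟨Skel.cellGeomSG Φ C t Λ, q, δc⟩` (stmt-g7's `SkelConc.concSchemeSG`, an `abbrev` — everything here is stated for the
  literal structure and transfers by `rfl`): `Skel.cellGeomSG_anchor`, `Skel.cellGeomSG_a₀`, **`Skel.tgt_add_stepVec_ne_zero`** (onward
  targets of a valid history are never the root cell, given `Φ.φ t = 0`), `Skel.realised_of_choice_SG`.
[cite: KozmaNitzan2024, §4 pp. 25–27 (the exploration process)]
-/

noncomputable section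

open scoped Classical

namespace Summit.CriticalPhenomena.PercolationContinuityZ3.Theorems

namespace Transplant

namespace Skel

open Literature.Probability.Percolation Literature.Probability.LatticeModels SimpleGraph GadgetSystem Contour KNCells
open Literature.Probability.Percolation.KozmaNitzan.Cells (stepVec_apply_fst stepVec_apply_oth)
open BoxProdZ2 (Realised ConcRadiiG nQ nS gen0 Erad Frad gen0_stepVec gen0_stepVec_add_stepVec)

variable {V : Type} [DecidableEq V] {G : SimpleGraph V} [G.LocallyFinite]

/-! ## §1 Any unit-increment scheme -/

/-- **The anchors of a CHOSEN edge are realised** — generic over the vertex type and over every anchored-cells scheme with the unit-increment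
re-centring rule (the product's `BoxProdZ2.realised_of_choice`, whose proof used nothing else). [folklore] -/
theorem realised_of_choice [Countable V] {S : KSchA V ℕ} (hanch : ∀ a v P, S.Γ.anchor a v P = a + 1) (h0 : S.Γ.a₀ = 0)
    (h : ProbeHistory V) {e : Site 2 × MDir} (hc : (S.astOf₂ G h).st.choice = some e) :
    Realised (S.aOf₁ G h e) (S.aOf₂ G h e) (tgt e) := by
  have hx : tgt e ≠ 0 := KSchA.tgt_ne_zero_of_choice h hc
  rcases KSchA.anchors_of_choice_succ hanch h0 h hc with hβ | ⟨he1, hα, hβ⟩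
  · by_cases hα : S.aOf₁ G h e = 0
    · have h1 : S.aOf₂ G h e = 1 := by rw [hβ, hα]
      obtain ⟨d, hd⟩ := KSchA.src_eq_step_of_choice_dep_one hanch h0 h h1
      refine Or.inr (Or.inl ⟨hα, h1, hx, d, e.2, ?_⟩)
      show e.1 + stepVec e.2 = stepVec d + stepVec e.2
      rw [hd]; show (0 + stepVec d) + stepVec e.2 = stepVec d + stepVec e.2; rw [zero_add]
    · exact Or.inl ⟨hβ, Nat.one_le_iff_ne_zero.2 hα⟩
  · refine Or.inr (Or.inr ⟨hα, hβ, e.2, ?_⟩)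
    show e.1 + stepVec e.2 = stepVec e.2
    rw [he1, zero_add]

/-- **The planar ℓ¹-position of the examined cell is dominated by its cube level**: `‖tgt e‖₁ ≤ nQ (aOf₁) (tgt e)` at every chosen edge
(`‖tgt e‖₁ ≤ aOf₁ + 2` from `KNCells2AnchorNorm`; for `aOf₁ = 0` the target has generation `≤ 2`, so `gen0 = ‖·‖₁`). This is the hypothesis
of `Skel.concRadiiS_rQ_eq_of_norm_le`: the max-inflated cube radius of the generic schedule is inactive at every run pair. [folklore] -/
theorem l1_tgt_le_nQ [Countable V] {S : KSchA V ℕ} (hanch : ∀ a v P, S.Γ.anchor a v P = a + 1) (h0 : S.Γ.a₀ = 0)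
    (h : ProbeHistory V) {e : Site 2 × MDir} (hc : (S.astOf₂ G h).st.choice = some e) :
    (tgt e 0).natAbs + (tgt e 1).natAbs ≤ nQ (S.aOf₁ G h e) (tgt e) := by
  have h2 := KSchA.norm_tgt_le_aOf₁_add_two hanch h0 h hc
  unfold l1 at h2
  unfold nQ
  split_ifs with hα
  · rw [hα] at h2
    unfold gen0
    omega
  · omega

/-! ## §2 The cell geometry of record `Skel.cellGeomSG` -/

section SG

variable (Φ : PlanarSkeletonConc G) (C : PCells) (t : V) (Λ : ConcRadiiG) (q : unitInterval) (δc : ℝ)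

/-- The re-centring rule of `cellGeomSG` is `a ↦ a + 1`. [folklore] -/
theorem cellGeomSG_anchor : ∀ a v P, (⟨cellGeomSG Φ C t Λ, q, δc⟩ : KSchA V ℕ).Γ.anchor a v P = a + 1 := fun _ _ _ => rfl

/-- The root anchor of `cellGeomSG` is `0`. [folklore] -/
theorem cellGeomSG_a₀ : (⟨cellGeomSG Φ C t Λ, q, δc⟩ : KSchA V ℕ).Γ.a₀ = 0 := rfl

variable {Φ C t Λ q δc}

/-- **The anchors of a chosen edge of the scheme of record are realised.** [folklore] -/
theorem realised_of_choice_SG [Countable V] (h : ProbeHistory V) {e : Site 2 × MDir}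
    (hc : ((⟨cellGeomSG Φ C t Λ, q, δc⟩ : KSchA V ℕ).astOf₂ G h).st.choice = some e) :
    Realised ((⟨cellGeomSG Φ C t Λ, q, δc⟩ : KSchA V ℕ).aOf₁ G h e) ((⟨cellGeomSG Φ C t Λ, q, δc⟩ : KSchA V ℕ).aOf₂ G h e) (tgt e) :=
  realised_of_choice (cellGeomSG_anchor Φ C t Λ q δc) (cellGeomSG_a₀ Φ C t Λ q δc) h hc

/-- **Onward targets are never the root cell** (root in base position `Φ.φ t = 0`): after a valid history the root is explored, so the column of
the root cell `x = 0` is not onward. [cite: KozmaNitzan2024, §4 p. 27 ((29))] -/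
theorem tgt_add_stepVec_ne_zero [Countable V] (hφ : Φ.φ t = 0) {h : ProbeHistory V} {e : Site 2 × MDir}
    (hV : (⟨cellGeomSG Φ C t Λ, q, δc⟩ : KSchA V ℕ).Valid₂ G h e) {du : MDir}
    (hdu : du ∈ (⟨cellGeomSG Φ C t Λ, q, δc⟩ : KSchA V ℕ).onward G h (tgt e)) : tgt e + stepVec du ≠ 0 := by
  intro h0
  have hroot := hV.root_mem
  have hon := (Finset.mem_filter.1 hdu).2 _ hroot
  apply hon
  show Φ.φ t = C.cen (tgt e + stepVec du)
  rw [h0, BoxProdZ2.PCells.cen_zero, hφ]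

/-- The same for every history PRODUCED by the scheme (`hst₂`), from the run invariant's `Q_0 ⊆ Vx` and `root ∈ Q_0` (`SepGeom.root_mem`
under `Skel.WFS` and `Φ.φ t = 0`) — no validity needed. [folklore] -/
theorem tgt_add_stepVec_ne_zero_of_run [Countable V] (hΛ : WFS C Λ) (hφ : Φ.φ t = 0) (ω : BondConfig V) (n : ℕ) (x : Site 2)
    {du : MDir} (hdu : du ∈ (⟨cellGeomSG Φ C t Λ, q, δc⟩ : KSchA V ℕ).onward G
      ((⟨cellGeomSG Φ C t Λ, q, δc⟩ : KSchA V ℕ).hst₂ G ω n) x) : x + stepVec du ≠ 0 := by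
  intro h0
  have hI := KSchA.runInv₂ (S := (⟨cellGeomSG Φ C t Λ, q, δc⟩ : KSchA V ℕ)) (G := G) (runGeomSG Φ C t) (anchGeomSG Φ C t) ω n
  have hroot : t ∈ (⟨cellGeomSG Φ C t Λ, q, δc⟩ : KSchA V ℕ).Vx G ((⟨cellGeomSG Φ C t Λ, q, δc⟩ : KSchA V ℕ).hst₂ G ω n) :=
    hI.Q0_sub (sepGeomSG Φ C t hΛ hφ).root_mem
  have hon := (Finset.mem_filter.1 hdu).2 _ hroot
  apply hon
  show Φ.φ t = C.cen (x + stepVec du)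
  rw [h0, BoxProdZ2.PCells.cen_zero, hφ]

end SG

/-! ## §3 APPEND (p5-g4, 20:3xZ): the (C) habitat radii at a chosen edge — for the Ω-packaging of the corridor chain (p3-g4 ruling
20:22:53Z: Ω := Ucor, regions `WinIn Φ Ucor (Sched.region i)`).  At a chosen edge `e = (v → x)` with `α = aOf₁`, `β = aOf₂` and an onward
`du`, over the schedule `Skel.concRadiiS C gap gap' E₀ L'` and with `E := Erad (nQ α x)`: cube radius `rQ α x = E` (max inactive),
between box `rB α v δ = E`, corridor profile `ρ β x du ℓ = E − 2` (all rows), far box `rE β x du = Frad (nQ α x + 1) − 1`, arrival cube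
`rM β (x+du) = Frad (nQ α x + 1) − L'`, and `nQ α x = nS α v + 1` (the examined cube is one generation above the source). -/

section ReachRadii

variable (Φ : PlanarSkeletonConc G) (C : PCells) (t : V) (gap gap' : ℕ → ℕ) (E₀ L' : ℕ) (q : unitInterval) (δc : ℝ)

/-- **At a chosen edge the examined cube is one generation above the source's own level**: `nQ α (tgt e) = nS α e.1 + 1` for EVERY
unit-increment scheme (the product's `nQ_tgt_eq_nS_src_succ`, generic). [folklore] -/
theorem nQ_tgt_eq_nS_src_succ [Countable V] {S : KSchA V ℕ} (hanch : ∀ a v P, S.Γ.anchor a v P = a + 1) (h0 : S.Γ.a₀ = 0)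
    (h : ProbeHistory V) {e : Site 2 × MDir} (hc : (S.astOf₂ G h).st.choice = some e) :
    nQ (S.aOf₁ G h e) (tgt e) = nS (S.aOf₁ G h e) e.1 + 1 := by
  set α := S.aOf₁ G h e with hα
  by_cases hα0 : α = 0
  · rw [hα0, nQ, nS, if_pos rfl, if_pos rfl]
    rcases KSchA.anchors_of_choice_succ hanch h0 h hc with hβ | ⟨he1, -, -⟩
    · have hβ1 : S.aOf₂ G h e = 1 := by rw [hβ, ← hα, hα0]
      obtain ⟨d, hd⟩ := KSchA.src_eq_step_of_choice_dep_one hanch h0 h hβ1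
      have he1 : e.1 = stepVec d := by rw [hd]; simp [GadgetSystem.tgt]
      have hne : e.1 ≠ 0 := by rw [he1]; exact stepVec_ne_zero d
      have hx : tgt e = stepVec d + stepVec e.2 := by simp [GadgetSystem.tgt, he1]
      rw [if_neg hne, hx, gen0_stepVec_add_stepVec (by rw [← hx]; exact KSchA.tgt_ne_zero_of_choice h hc)]
    · rw [if_pos he1, show tgt e = stepVec e.2 by simp [GadgetSystem.tgt, he1], gen0_stepVec]
  · rw [nQ, nS, if_neg hα0, if_neg hα0]

variable {Φ C t gap gap' E₀ L' q δc}

/-- **The (C) habitat radii at a chosen edge of the scheme of record** (see the section docstring). [this work] -/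
theorem reach_radii_concSG [Countable V] (hgap : ∀ n, 20 * C.r ≤ gap n) (hE₀ : 1 ≤ E₀) (hφ : Φ.φ t = 0)
    {h : ProbeHistory V} {e : Site 2 × MDir}
    (hc : ((⟨cellGeomSG Φ C t (concRadiiS C gap gap' E₀ L'), q, δc⟩ : KSchA V ℕ).astOf₂ G h).st.choice = some e)
    (hV : (⟨cellGeomSG Φ C t (concRadiiS C gap gap' E₀ L'), q, δc⟩ : KSchA V ℕ).Valid₂ G h e) {du : MDir}
    (hdu : du ∈ (⟨cellGeomSG Φ C t (concRadiiS C gap gap' E₀ L'), q, δc⟩ : KSchA V ℕ).onward G h (tgt e)) :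
    let α := (⟨cellGeomSG Φ C t (concRadiiS C gap gap' E₀ L'), q, δc⟩ : KSchA V ℕ).aOf₁ G h e
    let β := (⟨cellGeomSG Φ C t (concRadiiS C gap gap' E₀ L'), q, δc⟩ : KSchA V ℕ).aOf₂ G h e
    (concRadiiS C gap gap' E₀ L').rQ α (tgt e) = Erad gap gap' E₀ (nQ α (tgt e)) ∧
    (concRadiiS C gap gap' E₀ L').rB α e.1 e.2 = Erad gap gap' E₀ (nQ α (tgt e)) ∧
    (∀ ℓ, (concRadiiS C gap gap' E₀ L').ρ β (tgt e) du ℓ = Erad gap gap' E₀ (nQ α (tgt e)) - 2) ∧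
    (concRadiiS C gap gap' E₀ L').rE β (tgt e) du = Frad gap gap' E₀ (nQ α (tgt e) + 1) - 1 ∧
    (concRadiiS C gap gap' E₀ L').rM β (tgt e + stepVec du) = Frad gap gap' E₀ (nQ α (tgt e) + 1) - L' ∧
    nQ α (tgt e) = nS α e.1 + 1 := by
  intro α β
  have hreal : Realised α β (tgt e) := realised_of_choice_SG h hc
  have hy : tgt e + stepVec du ≠ 0 := tgt_add_stepVec_ne_zero hφ hV hdu
  obtain ⟨h1, h2, h3⟩ := hreal.sched_hyps hy
  refine ⟨?_, rfl, fun ℓ => ?_, ?_, ?_, ?_⟩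
  · exact concRadiiS_rQ_eq_of_norm_le C gap gap' E₀ L' hgap hE₀
      (l1_tgt_le_nQ (cellGeomSG_anchor Φ C t _ q δc) (cellGeomSG_a₀ Φ C t _ q δc) h hc)
  · rw [concRadiiS_ρ_eq C gap gap' E₀ L' h1 h2 ℓ, hreal.nS_eq]
  · rw [concRadiiS_rE_eq C gap gap' E₀ L' h3, hreal.nS_eq]
  · rw [concRadiiS_rM, hreal.nQ_add_stepVec hy]
  · exact nQ_tgt_eq_nS_src_succ (cellGeomSG_anchor Φ C t _ q δc) (cellGeomSG_a₀ Φ C t _ q δc) h hc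

end ReachRadii

end Skel

end Transplant

end Summit.CriticalPhenomena.PercolationContinuityZ3.Theorems

end
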